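import Summits.SmoothPoincare4.SmoothPoincare4.Theorems.EntropyRungRecognitionOfShrinkerGaps
import Literature.Geometry.Riemannian.RicciFlowShortTimeProofs
import Literature.Geometry.Riemannian.PerelmanEntropyMonotonicityProofs
import HarnessLib

/-!
# `EntropyRung.RecognitionOfShrinkerGaps` (stmt-SmoothPoincare4-14742) and the crux
# `EntropyRung.SubcylindricalRecognition` (stmt-SmoothPoincare4-10869), conditionally on Bamler's theorem ONLY

`EntropyRungRecognitionOfShrinkerGaps.lean` (p91718) proves the glue item
`RecognitionOfShrinkerGaps : NoncompactShrinkerGap → CompactShrinkerGap → SubcylindricalRecognition` — the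
Perelman–Bamler reduction of line `ancient-sphere-rigidity` — conditionally on THREE named published facts:
F1 `ricciFlow_shortTime_existence` (Hamilton 1982), F2 `perelman_muEntropy_monotone` (Perelman 2002 (3.4)) and
N1 `bamler_orbifoldTangentFlowAtInfinity_four` (Bamler 2020a–c). F1 and F2 have since been DISCHARGED in the tree
(`Literature.Geometry.Riemannian.ricciFlow_shortTime_existence_holds`, RicciFlowShortTimeProofs.lean;
`Literature.Geometry.Riemannian.perelman_muEntropy_monotone_holds`, PerelmanEntropyMonotonicityProofs.lean), so the
trust base of the reduction is now the single named fact N1. This file records the F1/F2-free forms: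

* `RecognitionOfShrinkerGaps.blowupSequence` — the blow-up sequence of rescaled compact flows with `|Rm| ≤ 1`,
  a non-flat anchor, `κ`-noncollapsing and Perelman's floor, now UNCONDITIONAL;
* `RecognitionOfShrinkerGaps.subcylindricalRecognition_of_bamler : N1 → NoncompactShrinkerGap →
  CompactShrinkerGap → SubcylindricalRecognition`;
* `recognitionOfShrinkerGaps_of_bamler : N1 → RecognitionOfShrinkerGaps` (deciding theorem of stmt-14742,
  `proof.conditional` on N1 alone).
-/

noncomputable section

open scoped Manifold ContDiff Topology ENNReal NNReal
open Set MeasureTheory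
open Literature.Geometry.Lorentzian Literature.Geometry.Riemannian
open Summit.SmoothPoincare4.SmoothPoincare4.Theorems.SubcylindricalRecognition.AncientSphereRigidity

namespace Summit.SmoothPoincare4.SmoothPoincare4.Theorems

namespace RecognitionOfShrinkerGaps

/-- **The blow-up sequence, unconditionally** (line `ancient-sphere-rigidity`, `stub_blowupSequence`): from a closed
connected Riemannian 4-manifold `(M, g)` with `R > 0` and the floor `μ(g, τ) ≥ ν_cyl + δ` for all `τ > 0`, the
maximal Ricci flow (Hamilton's short-time existence, now `ricciFlow_shortTime_existence_holds`; finite singular time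
from `R > 0`, curvature blow-up), Perelman's floor and no-local-collapsing along it (`perelman_muEntropy_monotone_holds`),
point picking and parabolic rescaling give Ricci flows on `M × [-A_k, 0]`, `A_k ≥ k`, with `|Rm| ≤ 1`, a non-flat
anchor `|Rm|(x_k, 0) ≥ c > 0`, `κ`-noncollapsing below `√A_k` and the floor `μ ≥ ν_cyl + δ'`.
This is `blowupSequence_of` (p91718) at the two discharged facts.
[cite: Hamilton1982, Thm. 4.2] [cite: Perelman2002, §3.1, (3.4); §4, Thm. 4.1] -/
theorem blowupSequence :
    ∀ (M : Type) [TopologicalSpace M] [T2Space M] [SecondCountableTopology M]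
      [ChartedSpace (EuclideanSpace ℝ (Fin 4)) M] [IsManifold (𝓡 4) ∞ M] [CompactSpace M]
      [ConnectedSpace M] [T3Space M] [MeasurableSpace M] [BorelSpace M]
      (g : PseudoRiemannianMetric (𝓡 4) ∞ (EuclideanSpace ℝ (Fin 4)) (TangentSpace (𝓡 4) : M → Type _))
      [g.HasLeviCivita] (hg : g.IsRiemannian),
      (∀ x : M, 0 < g.scalarCurvature x) →
      (∃ δ : ℝ, 0 < δ ∧ ∀ τ : ℝ, 0 < τ → ∀ f : M → ℝ, ContMDiff (𝓡 4) 𝓘(ℝ, ℝ) ∞ f →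
        ∫ x, (4 * Real.pi * τ) ^ (-(4 : ℝ) / 2) * Real.exp (-f x)
          ∂(riemannianMeasure (g.toContMDiffRiemannianMetric hg)) = 1 →
        Real.log 2 + Real.log Real.pi / 2 - 3 / 2 + δ ≤
          ∫ x, (τ * (g.scalarCurvature x + g.gradSq f x) + f x - 4) *
            ((4 * Real.pi * τ) ^ (-(4 : ℝ) / 2) * Real.exp (-f x))
            ∂(riemannianMeasure (g.toContMDiffRiemannianMetric hg))) →
      ∃ (κ δ' c : ℝ), 0 < κ ∧ 0 < δ' ∧ 0 < c ∧
        ∃ (A : ℕ → ℝ)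
          (gk : ℕ → ℝ → PseudoRiemannianMetric (𝓡 4) ∞ (EuclideanSpace ℝ (Fin 4)) (TangentSpace (𝓡 4) : M → Type _))
          (covk : ℕ → ℝ → CovariantDerivative (𝓡 4) (EuclideanSpace ℝ (Fin 4)) (TangentSpace (𝓡 4) : M → Type _))
          (xk : ℕ → M),
          (∀ k : ℕ, (k : ℝ) ≤ A k) ∧
          (∀ k, IsRicciFlow (gk k) (covk k) (Set.Icc (-(A k)) 0)) ∧
          (∀ k, ∀ t ∈ Set.Icc (-(A k)) 0, (gk k t).IsRiemannian) ∧
          (∀ k, ∀ t ∈ Set.Icc (-(A k)) 0, CurvatureBoundedBy (gk k t) (covk k t) 1) ∧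
          (∀ k, ∃ X Y Z W : TangentSpace (𝓡 4) (xk k),
            (gk k 0).val (xk k) X X ≤ 1 ∧ (gk k 0).val (xk k) Y Y ≤ 1 ∧
            (gk k 0).val (xk k) Z Z ≤ 1 ∧ (gk k 0).val (xk k) W W ≤ 1 ∧
            c ≤ |(gk k 0).curvatureForm (covk k 0) (xk k) X Y Z W|) ∧
          (∀ k, ∀ r₀ : ℝ, 0 < r₀ → r₀ < Real.sqrt (A k) →
            IsKappaNoncollapsed (gk k) (covk k) (Set.Icc (-(A k)) 0) κ r₀) ∧
          (∀ k, ∀ t ∈ Set.Icc (-(A k)) 0, ∀ τ : ℝ, 0 < τ →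
            ((Real.log 2 + Real.log Real.pi / 2 - 3 / 2 + δ' : ℝ) : EReal) ≤
              (gk k t).muEntropy (covk k t) τ) :=
  blowupSequence_of ricciFlow_shortTime_existence_holds perelman_muEntropy_monotone_holds

/-- **RUNG from the two gaps, conditionally on Bamler's theorem only**: `SubcylindricalRecognition` follows from
N1 `bamler_orbifoldTangentFlowAtInfinity_four`, `NoncompactShrinkerGap` and `CompactShrinkerGap`
(`subcylindricalRecognition_of_facts`, p91718, at the discharged F1, F2). [cite: Bamler2020Structure, §2.7 Thm 2.40] -/
theorem subcylindricalRecognition_of_bamler (hN1 : bamler_orbifoldTangentFlowAtInfinity_four)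
    (h₂ : _root_.Summit.SmoothPoincare4.SmoothPoincare4.Theses.EntropyRung.NoncompactShrinkerGap)
    (h₄ : _root_.Summit.SmoothPoincare4.SmoothPoincare4.Theses.EntropyRung.CompactShrinkerGap) :
    _root_.Summit.SmoothPoincare4.SmoothPoincare4.Theses.EntropyRung.SubcylindricalRecognition :=
  subcylindricalRecognition_of_facts ricciFlow_shortTime_existence_holds perelman_muEntropy_monotone_holds hN1 h₂ h₄

end RecognitionOfShrinkerGaps

/-- **`RecognitionOfShrinkerGaps` (stmt-SmoothPoincare4-14742), conditionally on Bamler's theorem ONLY**: the two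
shrinker density gaps imply the rung, `NoncompactShrinkerGap → CompactShrinkerGap → SubcylindricalRecognition`,
modulo the single named fact N1 `Literature.Geometry.Riemannian.bamler_orbifoldTangentFlowAtInfinity_four`
(Bamler 2020a Prop. 5.2 / Thm. 10.1; 2020b; 2020c Thms. 2.4, 2.9, 2.16, 2.40, 2.46); Hamilton's short-time existence
and Perelman's `μ`-monotonicity, the other two hypotheses of `recognitionOfShrinkerGaps_of_facts` (p91718), are now
theorems of the tree. [cite: Bamler2020Structure, §2.7 Thm 2.40; §2.10 Thm 2.46] [cite: Perelman2002, §4, Thm. 4.1] -/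
theorem recognitionOfShrinkerGaps_of_bamler (hN1 : bamler_orbifoldTangentFlowAtInfinity_four) :
    _root_.Summit.SmoothPoincare4.SmoothPoincare4.Theses.EntropyRung.RecognitionOfShrinkerGaps :=
  recognitionOfShrinkerGaps_of_facts ricciFlow_shortTime_existence_holds perelman_muEntropy_monotone_holds hN1

end Summit.SmoothPoincare4.SmoothPoincare4.Theorems

end
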